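import Summits.Ventures.PercRepro.C025ProfileOneFlat

/-!
# THE TRIMMED INEQUALITY OF THE UNIFORM ONE-FLAT FAMILY AT EVERY `τ ≥ 1`: TELESCOPING BASE + MAJORIZATION (night-3 g24)

`proofs/NIGHT3-G24-ONEFLAT.md` §8.  Beyond the spanning regime (`τ := r + q − s − m ≥ 1`) the second row of
`T_r(U_{s,k} ⊕ U_{m,m})` reduces (complementation on the weight-1 members, §4(a)) to the TRIMMED inequality
`Σ_{c=τ}^{s} V_c · D_c ≥ 0`, `V_c = C(k,c)` (`τ ≤ c < s`), `V_s = Σ_{i=s}^{k−τ} C(k,i)`, `D_c = (q+1)·C(m,r−1−c) − r·C(m,q−c)·[c ≤ q]`.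
With `P_x(b) := C(m, x−b)·[b ≤ x]` and `A(x) := Σ_{b=τ}^{s} C(k,b)·P_x(b)` (the `x`-subsets of a `(k+m)`-set whose block count lies in
the window `[τ, s]`), the double count of the pairs `B ⊂ B'` telescopes:
`(x+1)·A(x+1) − (k+m−x)·A(x) = Σ_b [g(b−1) − g(b)]`, `g(b) = (k−b)·C(k,b)·P_x(b)` (`telescope_step`, `telescope_window`); for the THIN
flat `k = s + τ` the supply sum is `A(q+1)` after the reflection `c ↦ s + τ − c` (`reflect_sum`), so the base
`Σ_{c=τ}^{s} C(s+τ,c)·D_c = τ·C(s+τ,τ)·(C(m, q+1−τ) − C(m, q−s)·[s ≤ q]) ≥ 0` (`thin_base`, `thin_base_nonneg`: unimodality).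
The majorization against an abstract base on an index set (`majorize_base`) then gives the trimmed inequality for every
`k ≥ s + τ` (`trimmed_nonneg`: `C(k,c)/C(s+τ,c)` is non-decreasing).
No `def`, no `instance`, no notation.  Axioms: standard.
-/

namespace PercRepro

open Finset

namespace OneFlat

/-- The absorption identity `b · C(k, b) = (k − b + 1) · C(k, b − 1)` for `1 ≤ b ≤ k`, in `ℚ`. -/
theorem choose_absorb {k b : ℕ} (hb : 1 ≤ b) (hbk : b ≤ k) :
    (b : ℚ) * (k.choose b : ℚ) = ((k - b + 1 : ℕ) : ℚ) * (k.choose (b - 1) : ℚ) := by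
  have h := Nat.choose_succ_right_eq k (b - 1)
  rw [show b - 1 + 1 = b by omega, show k - (b - 1) = k - b + 1 by omega] at h
  have : b * k.choose b = (k - b + 1) * k.choose (b - 1) := by rw [mul_comm, h, mul_comm]
  exact_mod_cast this

/-- One telescoping step of the window double count: for `1 ≤ b ≤ k` and `x ≤ k + m`,
`(x+1)·C(k,b)·P_{x+1}(b) − (k+m−x)·C(k,b)·P_x(b) = g(b−1) − g(b)` with `g(b) = (k−b)·C(k,b)·P_x(b)`,
`P_y(b) = C(m, y−b)·[b ≤ y]`. -/
theorem telescope_step {k m x b : ℕ} (hb : 1 ≤ b) (hbk : b ≤ k) (hx : x ≤ k + m) :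
    ((x : ℚ) + 1) * (k.choose b : ℚ) * (if b ≤ x + 1 then (m.choose (x + 1 - b) : ℚ) else 0)
      - ((k + m - x : ℕ) : ℚ) * (k.choose b : ℚ) * (if b ≤ x then (m.choose (x - b) : ℚ) else 0)
    = ((k - (b - 1) : ℕ) : ℚ) * (k.choose (b - 1) : ℚ) * (if b - 1 ≤ x then (m.choose (x - (b - 1)) : ℚ) else 0)
      - ((k - b : ℕ) : ℚ) * (k.choose b : ℚ) * (if b ≤ x then (m.choose (x - b) : ℚ) else 0) := by
  have habs := choose_absorb (k := k) (b := b) hb hbk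
  rw [show k - (b - 1) = k - b + 1 by omega]
  rcases Nat.lt_or_ge (x + 1) b with h1 | h1
  · -- (i) `b > x + 1`: every guard is false
    rw [if_neg (by omega), if_neg (by omega), if_neg (by omega)]; simp
  rcases Nat.lt_or_ge x b with h2 | h2
  · -- (ii) `b = x + 1`
    have hbx : b = x + 1 := by omega
    rw [if_pos h1, if_neg (by omega), if_pos (by omega), show x + 1 - b = 0 by omega,
      show x - (b - 1) = 0 by omega]
    simp only [Nat.choose_zero_right, Nat.cast_one, mul_one, mul_zero, sub_zero]
    rw [show ((x : ℚ) + 1) = (b : ℚ) by rw [hbx]; push_cast; ring]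
    exact habs
  -- `b ≤ x`
  rw [if_pos h1, if_pos h2, if_pos (by omega), show x - (b - 1) = x + 1 - b by omega]
  rcases Nat.lt_or_ge m (x - b) with h3 | h3
  · -- (iii) `x − b > m`: the three binomials vanish
    rw [Nat.choose_eq_zero_of_lt h3, Nat.choose_eq_zero_of_lt (by omega : m < x + 1 - b)]; simp
  rcases Nat.eq_or_lt_of_le h3 with h4 | h4
  · -- (iv) `x − b = m`: `C(m, x+1−b) = 0`, `C(m, x−b) = 1`, and `k + m − x = k − b`
    rw [Nat.choose_eq_zero_of_lt (by omega : m < x + 1 - b), h4, Nat.choose_self]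
    have : k + m - x = k - b := by omega
    rw [this]; simp
  · -- (v) `x − b < m`: both absorptions
    have habs2 := choose_absorb (k := m) (b := x + 1 - b) (by omega) (by omega)
    rw [show x + 1 - b - 1 = x - b by omega] at habs2
    have e1 : ((x : ℚ) + 1) = (b : ℚ) + ((x + 1 - b : ℕ) : ℚ) := by
      rw [Nat.cast_sub (by omega : b ≤ x + 1)]; push_cast; ring
    have e2 : ((k + m - x : ℕ) : ℚ) = ((k - b : ℕ) : ℚ) + ((m - (x - b) + 1 : ℕ) : ℚ) - 1 := by
      have hnat : k + m - x + 1 = k - b + (m - (x - b) + 1) := by omega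
      have := congrArg (fun n : ℕ => (n : ℚ)) hnat
      push_cast at this ⊢
      linarith
    have e3 : ((k - b + 1 : ℕ) : ℚ) = ((k - b : ℕ) : ℚ) + 1 := by push_cast; ring
    have e4 : ((m - (x + 1 - b) + 1 : ℕ) : ℚ) + 1 = ((m - (x - b) + 1 : ℕ) : ℚ) := by
      have hnat : m - (x + 1 - b) + 1 + 1 = m - (x - b) + 1 := by omega
      have := congrArg (fun n : ℕ => (n : ℚ)) hnat
      push_cast at this ⊢
      linarith
    rw [e1, e2, e3]
    rw [e3] at habs
    linear_combination (m.choose (x + 1 - b) : ℚ) * habs + (k.choose b : ℚ) * habs2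
      + ((k.choose b : ℚ) * (m.choose (x - b) : ℚ)) * e4

/-- The window double count, summed: `(x+1)·A(x+1) − (k+m−x)·A(x) = g(τ−1) − g(s)` over the window `[τ, s]`, `1 ≤ τ ≤ s ≤ k`. -/
theorem telescope_window {k m x τ s : ℕ} (hτ : 1 ≤ τ) (hτs : τ ≤ s) (hsk : s ≤ k) (hx : x ≤ k + m) :
    ∑ b ∈ Ico τ (s + 1), (((x : ℚ) + 1) * (k.choose b : ℚ) * (if b ≤ x + 1 then (m.choose (x + 1 - b) : ℚ) else 0)
      - ((k + m - x : ℕ) : ℚ) * (k.choose b : ℚ) * (if b ≤ x then (m.choose (x - b) : ℚ) else 0))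
    = ((k - (τ - 1) : ℕ) : ℚ) * (k.choose (τ - 1) : ℚ) * (if τ - 1 ≤ x then (m.choose (x - (τ - 1)) : ℚ) else 0)
      - ((k - s : ℕ) : ℚ) * (k.choose s : ℚ) * (if s ≤ x then (m.choose (x - s) : ℚ) else 0) := by
  set g : ℕ → ℚ := fun b => ((k - b : ℕ) : ℚ) * (k.choose b : ℚ) * (if b ≤ x then (m.choose (x - b) : ℚ) else 0) with hg
  have hstep : ∀ b ∈ Ico τ (s + 1),
      ((x : ℚ) + 1) * (k.choose b : ℚ) * (if b ≤ x + 1 then (m.choose (x + 1 - b) : ℚ) else 0)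
        - ((k + m - x : ℕ) : ℚ) * (k.choose b : ℚ) * (if b ≤ x then (m.choose (x - b) : ℚ) else 0)
      = g (b - 1) - g b := by
    intro b hb
    rw [mem_Ico] at hb
    exact telescope_step (by omega) (by omega) hx
  rw [sum_congr rfl hstep, sum_Ico_eq_sum_range]
  have : ∑ j ∈ range (s + 1 - τ), (g (τ + j - 1) - g (τ + j)) = g (τ - 1) - g s := by
    have h := sum_range_sub' (fun j => g (τ + j - 1)) (s + 1 - τ)
    simp only [add_zero] at h
    rw [show τ + (s + 1 - τ) - 1 = s by omega] at h
    rw [← h]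
    apply sum_congr rfl
    intro j _
    rw [show τ + (j + 1) - 1 = τ + j by omega]
  rw [this]

/-- The reflection `c ↦ s + τ − c` of the window `[τ, s]` turns the supply sum into `A(q+1)`:
`Σ_{c=τ}^{s} C(s+τ,c)·C(m, r−1−c) = Σ_{b=τ}^{s} C(s+τ,b)·P_{q+1}(b)` when `m + s + τ = r + q` and `s + 1 ≤ r`. -/
theorem reflect_sum {s τ r q m : ℕ} (hm : m + s + τ = r + q) (hsr : s + 1 ≤ r) :
    ∑ c ∈ Ico τ (s + 1), ((s + τ).choose c : ℚ) * (m.choose (r - 1 - c) : ℚ)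
      = ∑ b ∈ Ico τ (s + 1), ((s + τ).choose b : ℚ) * (if b ≤ q + 1 then (m.choose (q + 1 - b) : ℚ) else 0) := by
  apply sum_nbij' (fun c => s + τ - c) (fun b => s + τ - b)
  · intro c hc; simp only [mem_Ico] at hc ⊢; omega
  · intro b hb; simp only [mem_Ico] at hb ⊢; omega
  · intro c hc; simp only [mem_Ico] at hc; omega
  · intro b hb; simp only [mem_Ico] at hb; omega
  · intro c hc
    simp only [mem_Ico] at hc
    rw [Nat.choose_symm (by omega : c ≤ s + τ)]
    congr 1
    by_cases hle : s + τ - c ≤ q + 1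
    · rw [if_pos hle]
      congr 1
      exact Nat.choose_symm_of_eq_add (by omega)
    · rw [if_neg hle]
      exact_mod_cast Nat.choose_eq_zero_of_lt (by omega)

/-- **THE THIN BASE TELESCOPES**: `Σ_{c=τ}^{s} C(s+τ,c)·D_c = τ·C(s+τ,τ)·(C(m, q+1−τ) − C(m, q−s)·[s ≤ q])` for
`1 ≤ τ ≤ s`, `m + s + τ = r + q`, `s + 1 ≤ r`, `τ ≤ q + 1`. -/
theorem thin_base {s τ r q m : ℕ} (hτ : 1 ≤ τ) (hτs : τ ≤ s) (hm : m + s + τ = r + q) (hsr : s + 1 ≤ r)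
    (hτq : τ ≤ q + 1) :
    ∑ c ∈ Ico τ (s + 1), ((s + τ).choose c : ℚ) *
        (((q : ℚ) + 1) * (m.choose (r - 1 - c) : ℚ) - (r : ℚ) * (if c ≤ q then (m.choose (q - c) : ℚ) else 0))
      = (τ : ℚ) * ((s + τ).choose τ : ℚ) *
          ((m.choose (q + 1 - τ) : ℚ) - (if s ≤ q then (m.choose (q - s) : ℚ) else 0)) := by
  have hw := telescope_window (k := s + τ) (m := m) (x := q) (τ := τ) (s := s) hτ hτs (by omega) (by omega)
  have hr : ((s + τ + m - q : ℕ) : ℚ) = (r : ℚ) := by congr 1; omega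
  rw [hr] at hw
  have hsplit : ∑ c ∈ Ico τ (s + 1), ((s + τ).choose c : ℚ) *
        (((q : ℚ) + 1) * (m.choose (r - 1 - c) : ℚ) - (r : ℚ) * (if c ≤ q then (m.choose (q - c) : ℚ) else 0))
      = ((q : ℚ) + 1) * ∑ c ∈ Ico τ (s + 1), ((s + τ).choose c : ℚ) * (m.choose (r - 1 - c) : ℚ)
        - (r : ℚ) * ∑ c ∈ Ico τ (s + 1), ((s + τ).choose c : ℚ) * (if c ≤ q then (m.choose (q - c) : ℚ) else 0) := by
    rw [mul_sum, mul_sum, ← sum_sub_distrib]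
    apply sum_congr rfl; intro c _; ring
  rw [hsplit, reflect_sum hm hsr]
  have hlhs : ((q : ℚ) + 1) * ∑ b ∈ Ico τ (s + 1), ((s + τ).choose b : ℚ) * (if b ≤ q + 1 then (m.choose (q + 1 - b) : ℚ) else 0)
        - (r : ℚ) * ∑ c ∈ Ico τ (s + 1), ((s + τ).choose c : ℚ) * (if c ≤ q then (m.choose (q - c) : ℚ) else 0)
      = ∑ b ∈ Ico τ (s + 1), (((q : ℚ) + 1) * ((s + τ).choose b : ℚ) * (if b ≤ q + 1 then (m.choose (q + 1 - b) : ℚ) else 0)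
          - (r : ℚ) * ((s + τ).choose b : ℚ) * (if b ≤ q then (m.choose (q - b) : ℚ) else 0)) := by
    rw [mul_sum, mul_sum, ← sum_sub_distrib]
    apply sum_congr rfl; intro c _; ring
  rw [hlhs, hw]
  -- `g(τ−1) = τ·C(s+τ,τ)·C(m, q+1−τ)` by absorption, `g(s) = τ·C(s+τ,s)·P_q(s)`, `C(s+τ,s) = C(s+τ,τ)`
  have h1 : ((s + τ - (τ - 1) : ℕ) : ℚ) * ((s + τ).choose (τ - 1) : ℚ) = (τ : ℚ) * ((s + τ).choose τ : ℚ) := by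
    have := choose_absorb (k := s + τ) (b := τ) hτ (by omega)
    rw [this]; congr 1; congr 1; omega
  have h2 : ((s + τ - s : ℕ) : ℚ) * ((s + τ).choose s : ℚ) = (τ : ℚ) * ((s + τ).choose τ : ℚ) := by
    rw [show s + τ - s = τ by omega, Nat.choose_symm_add]
  rw [h1, h2, if_pos (by omega : τ - 1 ≤ q), show q - (τ - 1) = q + 1 - τ by omega]
  ring

/-- The thin base is non-negative: `q − s ≤ q + 1 − τ` and `(q − s) + (q + 1 − τ) ≤ m` give `C(m, q−s) ≤ C(m, q+1−τ)`. -/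
theorem thin_base_nonneg {s τ r q m : ℕ} (hτ : 1 ≤ τ) (hτs : τ ≤ s) (hm : m + s + τ = r + q) (hsr : s + 1 ≤ r)
    (hq : q + 1 ≤ r) (hτq : τ ≤ q + 1) :
    0 ≤ ∑ c ∈ Ico τ (s + 1), ((s + τ).choose c : ℚ) *
        (((q : ℚ) + 1) * (m.choose (r - 1 - c) : ℚ) - (r : ℚ) * (if c ≤ q then (m.choose (q - c) : ℚ) else 0)) := by
  rw [thin_base hτ hτs hm hsr hτq]
  apply mul_nonneg (by positivity)
  by_cases hsq : s ≤ q
  · rw [if_pos hsq, sub_nonneg]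
    -- unimodality `C(m, q−s) ≤ C(m, q+1−τ)`: `q − s ≤ q + 1 − τ` and `(q − s) + (q + 1 − τ) ≤ m`
    rcases Nat.lt_or_ge (q + 1 - τ) (m / 2 + 1) with hb | hb
    · exact_mod_cast choose_le_choose_of_le_half (n := m) (x := q - s) (y := q + 1 - τ) (by omega) (by omega)
    · -- `q + 1 − τ > m/2`: `C(m, q+1−τ) = C(m, m − (q+1−τ))` and `q − s ≤ m − (q+1−τ) ≤ m/2`
      rw [← Nat.choose_symm (by omega : q + 1 - τ ≤ m)]
      exact_mod_cast choose_le_choose_of_le_half (n := m) (x := q - s) (y := m - (q + 1 - τ)) (by omega) (by omega)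
  · rw [if_neg hsq, sub_zero]; positivity

/-- **MAJORIZATION AGAINST AN ABSTRACT BASE** on an index set `I`: `β > 0`, `V ≥ 0`, `Σ_I β·D ≥ 0`, `V/β` non-decreasing
(cross-multiplied) and every negative `D` preceding every positive one give `Σ_I V·D ≥ 0`. -/
theorem majorize_base (I : Finset ℕ) (V β D : ℕ → ℚ) (hβ : ∀ c ∈ I, 0 < β c) (hV : ∀ c ∈ I, 0 ≤ V c)
    (hbase : 0 ≤ ∑ c ∈ I, β c * D c)
    (hmono : ∀ c' ∈ I, ∀ c ∈ I, c' ≤ c → V c' * β c ≤ V c * β c')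
    (horder : ∀ c' ∈ I, ∀ c ∈ I, D c' < 0 → 0 < D c → c' < c) :
    0 ≤ ∑ c ∈ I, V c * D c := by
  by_cases hneg : ∃ c ∈ I, D c < 0
  · obtain ⟨c₁, hc₁I, hc₁⟩ := hneg
    set N : Finset ℕ := I.filter (fun c => D c < 0) with hN
    have hNne : N.Nonempty := ⟨c₁, by simp only [hN, mem_filter]; exact ⟨hc₁I, hc₁⟩⟩
    set c₀ := N.max' hNne with hc₀
    have hc₀_mem : c₀ ∈ N := N.max'_mem hNne
    have hc₀I : c₀ ∈ I := by
      have := hc₀_mem; simp only [hN, mem_filter] at this; exact this.1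
    have hc₀_neg : D c₀ < 0 := by
      have := hc₀_mem; simp only [hN, mem_filter] at this; exact this.2
    have hle_c₀ : ∀ c ∈ I, D c < 0 → c ≤ c₀ := by
      intro c hc hDc
      exact N.le_max' c (by simp only [hN, mem_filter]; exact ⟨hc, hDc⟩)
    have hpt : ∀ c ∈ I, V c₀ * β c * D c ≤ V c * β c₀ * D c := by
      intro c hc
      rcases lt_trichotomy (D c) 0 with hDc | hDc | hDc
      · have hcc₀ : c ≤ c₀ := hle_c₀ c hc hDc
        have hm := hmono c hc c₀ hc₀I hcc₀
        nlinarith [hm, hDc]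
      · rw [hDc]; simp
      · have hc₀c : c₀ < c := horder c₀ hc₀I c hc hc₀_neg hDc
        have hm := hmono c₀ hc₀I c hc hc₀c.le
        nlinarith [hm, hDc]
    have hsumle := sum_le_sum hpt
    have hL : ∑ c ∈ I, V c₀ * β c * D c = V c₀ * ∑ c ∈ I, β c * D c := by
      rw [mul_sum]; apply sum_congr rfl; intro c _; ring
    have hR : ∑ c ∈ I, V c * β c₀ * D c = β c₀ * ∑ c ∈ I, V c * D c := by
      rw [mul_sum]; apply sum_congr rfl; intro c _; ring
    rw [hL, hR] at hsumle
    have hLnn : 0 ≤ V c₀ * ∑ c ∈ I, β c * D c := mul_nonneg (hV c₀ hc₀I) hbase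
    exact (mul_nonneg_iff_of_pos_left (hβ c₀ hc₀I)).1 (le_trans hLnn hsumle)
  · push Not at hneg
    apply sum_nonneg
    intro c hc
    exact mul_nonneg (hV c hc) (hneg c hc)

/-- **THE TRIMMED INEQUALITY FOR EVERY UNIFORM FLAT** `U_{s,k}`, `k ≥ s + τ`, `1 ≤ τ ≤ s`, `m + s + τ = r + q`, `s + 1 ≤ r`,
`q + 2 ≤ r`: `Σ_{c=τ}^{s} V_c · D_c ≥ 0` with `V_c = C(k,c)` for `c < s` and `V_s = Σ_{i=s}^{k−τ} C(k,i)`. -/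
theorem trimmed_nonneg {s τ k r q m : ℕ} (hτ : 1 ≤ τ) (hτs : τ ≤ s) (hk : s + τ ≤ k) (hm : m + s + τ = r + q)
    (hsr : s + 1 ≤ r) (hrm : r ≤ s + m) (hq : q + 2 ≤ r) :
    0 ≤ ∑ c ∈ Ico τ (s + 1),
      (if c < s then (k.choose c : ℚ) else ∑ i ∈ Ico s (k - τ + 1), (k.choose i : ℚ)) *
        (((q : ℚ) + 1) * (m.choose (r - 1 - c) : ℚ) - (r : ℚ) * (if c ≤ q then (m.choose (q - c) : ℚ) else 0)) := by
  have hτq : τ ≤ q + 1 := by omega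
  apply majorize_base (Ico τ (s + 1)) _ (fun c => ((s + τ).choose c : ℚ)) _
  · intro c hc
    rw [mem_Ico] at hc
    exact_mod_cast Nat.choose_pos (by omega)
  · intro c _
    split_ifs
    · positivity
    · exact sum_nonneg (fun i _ => by positivity)
  · exact thin_base_nonneg hτ hτs hm hsr (by omega) hτq
  · intro c' hc' c hc hc'c
    rw [mem_Ico] at hc' hc
    -- `V_{c'} · C(s+τ,c) ≤ V_c · C(s+τ,c')`
    have hlem : ∀ a b, a ≤ b → b ≤ s → (k.choose a : ℚ) * ((s + τ).choose b : ℚ) ≤ (k.choose b : ℚ) * ((s + τ).choose a : ℚ) := by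
      intro a b hab hbs
      exact_mod_cast choose_mul_choose_le_choose_mul_choose (k := k) (s := s + τ) hab (by omega) hk
    have hVs : (k.choose s : ℚ) ≤ ∑ i ∈ Ico s (k - τ + 1), (k.choose i : ℚ) :=
      single_le_sum (f := fun i => (k.choose i : ℚ)) (fun i _ => by positivity) (by rw [mem_Ico]; omega)
    by_cases hcs : c < s
    · rw [if_pos hcs, if_pos (by omega)]
      exact hlem c' c hc'c hcs.le
    · rw [if_neg hcs]
      have hcs' : c = s := by omega
      subst hcs'
      by_cases hc's : c' < c
      · rw [if_pos hc's]
        calc (k.choose c' : ℚ) * ((c + τ).choose c : ℚ) ≤ (k.choose c : ℚ) * ((c + τ).choose c' : ℚ) :=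
              hlem c' c hc'c le_rfl
          _ ≤ (∑ i ∈ Ico c (k - τ + 1), (k.choose i : ℚ)) * ((c + τ).choose c' : ℚ) :=
              mul_le_mul_of_nonneg_right hVs (by positivity)
      · rw [if_neg hc's]
        have : c' = c := by omega
        subst this
        exact le_rfl
  · intro c' _ c _ hneg hpos
    exact lt_of_D_neg_of_D_pos (m := m) (r := r) (q := q) (by omega) hneg hpos

end OneFlat

end PercRepro
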